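import Mathlib
import Literature.Probability.LatticeModels.GKSInequalities
import Literature.Probability.LatticeModels.IsingFKG
import HarnessLib

/-!
# Crux `PrecisionLaplacian.InverseMFerromagnet` (stmt-CriticalPhenomena-4798), line `Sketch` —
# stub `stub_condCov_nonneg`: conditional covariances of a pair ferromagnet are nonnegative

THEOREM-ONLY file (no definitions).  For the zero-field pair ferromagnet
`ν(ω) ∝ exp(∑ᵢ Kᵢ σ_{Cᵢ}(ω))` on `{±1}^{Fin n}` with `Kᵢ ≥ 0` and `|Cᵢ| = 2`
(`gksExpect univ K C` of `Literature.Probability.LatticeModels.GKSInequalities`) and the cylinder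
indicators `1_s(ω) = ∏_{p ∈ S} (1 + s_p σ_p(ω))/2` (`s : S → ℤˣ`; `1_s(ω) = 1` iff `ω ≡ s` on `S`),
we prove
`∑_s ⟨σ_x 1_s⟩ ⟨σ_y 1_s⟩ / ⟨1_s⟩ ≤ ⟨σ_x σ_y⟩`,
i.e. `E[Cov(σ_x, σ_y | σ_S)] ≥ 0` — the first term of the law of total covariance used at every
level of the partial-covariance ladder of the line `Sketch`.

Proof.  `∑_s 1_s = 1`, so `⟨σ_xσ_y⟩ = ∑_s ⟨σ_xσ_y 1_s⟩` and it suffices that for each `s`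
`⟨σ_x 1_s⟩⟨σ_y 1_s⟩ ≤ ⟨1_s⟩⟨σ_xσ_y 1_s⟩`.  This is Mathlib's FKG inequality `fkg` (a corollary
of the Ahlswede–Daykin four functions theorem) on the finite distributive lattice `{±1}^{Fin n}`
(`-1 < 1`, product order) for the log-supermodular weight `1_s · exp(∑ Kᵢ σ_{Cᵢ})` — pair
interactions are supermodular (`spin_mul_supermodular` of `IsingFKG`), and the indicator of a
cylinder is log-supermodular — and the nonnegative nondecreasing observables `1 + σ_x`, `1 + σ_y`;
expanding `(1 + σ_x)(1 + σ_y)` the linear terms cancel.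
-/

namespace Summit.CriticalPhenomena.Ising3DConformalLimit.Cruxes.InverseMFerromagnet.PartialCovarianceLadder

open Literature.Probability.LatticeModels Finset Matrix

noncomputable section

/-! ## The cylinder indicator `1_s(ω) = ∏_{p ∈ S} (1 + s_p σ_p(ω))/2` -/

/-- One factor of the cylinder indicator: for `a, b = ±1`, `(1 + a b)/2 = 1[b = a]`. [folklore] -/
theorem cyl_factor_eq_ite (a b : ℤˣ) :
    (1 + ((a : ℤ) : ℝ) * ((b : ℤ) : ℝ)) / 2 = if b = a then 1 else 0 := by
  by_cases h : b = a
  · subst h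
    rw [if_pos rfl, ← Int.cast_mul, Int.units_coe_mul_self]
    norm_num
  · rw [if_neg h, Int.units_ne_iff_eq_neg.1 h, Units.val_neg, Int.cast_neg, mul_neg, ← Int.cast_mul,
      Int.units_coe_mul_self]
    norm_num

/-- The cylinder "indicator" is the indicator of the cylinder:
`∏_{p ∈ S} (1 + s_p σ_p(ω))/2 = 1[ω ≡ s on S]`. [folklore] -/
theorem cyl_eq_ite {n : ℕ} (S : Finset (Fin n)) (s : ↥S → ℤˣ) (ω : SpinConfig (Fin n)) :
    (∏ p : ↥S, (1 + (((s p : ℤˣ) : ℤ) : ℝ) * spinAt p.1 ω) / 2) =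
      if (∀ p : ↥S, ω p.1 = s p) then 1 else 0 := by
  simp only [spinAt, cyl_factor_eq_ite]
  exact Fintype.prod_boole

/-- `0 ≤ 1_s(ω)`. [folklore] -/
theorem cyl_nonneg {n : ℕ} (S : Finset (Fin n)) (s : ↥S → ℤˣ) (ω : SpinConfig (Fin n)) :
    0 ≤ ∏ p : ↥S, (1 + (((s p : ℤˣ) : ℤ) : ℝ) * spinAt p.1 ω) / 2 := by
  rw [cyl_eq_ite]
  split_ifs <;> norm_num

/-- `∑_s 1_s(ω) = 1`: exactly one cylinder over `S` contains `ω`. [folklore] -/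
theorem sum_cyl_eq_one {n : ℕ} (S : Finset (Fin n)) (ω : SpinConfig (Fin n)) :
    ∑ s : ↥S → ℤˣ, ∏ p : ↥S, (1 + (((s p : ℤˣ) : ℤ) : ℝ) * spinAt p.1 ω) / 2 = 1 := by
  simp only [cyl_eq_ite]
  rw [Finset.sum_eq_single (fun p : ↥S => ω p.1)]
  · exact if_pos fun _ => rfl
  · intro s _ hs
    rw [if_neg]
    intro h
    exact hs (funext fun p => (h p).symm)
  · intro h
    exact absurd (Finset.mem_univ _) h

/-- The cylinder indicator is log-supermodular: `1_s(a) 1_s(b) ≤ 1_s(a ∧ b) 1_s(a ∨ b)` (if `a` and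
`b` agree with `s` on `S`, so do `a ∧ b` and `a ∨ b`). [folklore] -/
theorem cyl_lattice {n : ℕ} (S : Finset (Fin n)) (s : ↥S → ℤˣ) (a b : SpinConfig (Fin n)) :
    (∏ p : ↥S, (1 + (((s p : ℤˣ) : ℤ) : ℝ) * spinAt p.1 a) / 2) *
        (∏ p : ↥S, (1 + (((s p : ℤˣ) : ℤ) : ℝ) * spinAt p.1 b) / 2) ≤
      (∏ p : ↥S, (1 + (((s p : ℤˣ) : ℤ) : ℝ) * spinAt p.1 (a ⊓ b)) / 2) *
        (∏ p : ↥S, (1 + (((s p : ℤˣ) : ℤ) : ℝ) * spinAt p.1 (a ⊔ b)) / 2) := by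
  simp only [cyl_eq_ite]
  by_cases ha : ∀ p : ↥S, a p.1 = s p
  · by_cases hb : ∀ p : ↥S, b p.1 = s p
    · have h1 : ∀ p : ↥S, (a ⊓ b) p.1 = s p := fun p => by
        rw [Pi.inf_apply, ha p, hb p, inf_idem]
      have h2 : ∀ p : ↥S, (a ⊔ b) p.1 = s p := fun p => by
        rw [Pi.sup_apply, ha p, hb p, sup_idem]
      rw [if_pos ha, if_pos hb, if_pos h1, if_pos h2]
    · rw [if_neg hb, mul_zero]
      exact mul_nonneg (by split_ifs <;> norm_num) (by split_ifs <;> norm_num)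
  · rw [if_neg ha, zero_mul]
    exact mul_nonneg (by split_ifs <;> norm_num) (by split_ifs <;> norm_num)

/-- Every cylinder has positive mass: `Z ⟨1_s⟩ > 0` (the configuration `s` glued with `+` outside `S`
lies in it). [folklore] -/
theorem gksSum_cyl_pos {n m : ℕ} (K : Fin m → ℝ) (C : Fin m → Finset (Fin n)) (S : Finset (Fin n))
    (s : ↥S → ℤˣ) :
    0 < gksSum Finset.univ K C
      (fun ω => ∏ p : ↥S, (1 + (((s p : ℤˣ) : ℤ) : ℝ) * spinAt p.1 ω) / 2) := by
  classical
  simp only [gksSum]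
  set ω₀ : SpinConfig (Fin n) := fun q => if h : q ∈ S then s ⟨q, h⟩ else 1 with hω₀
  have h1 : (∏ p : ↥S, (1 + (((s p : ℤˣ) : ℤ) : ℝ) * spinAt p.1 ω₀) / 2) = 1 := by
    rw [cyl_eq_ite, if_pos]
    intro p
    simp [hω₀, p.2]
  calc (0 : ℝ) < (∏ p : ↥S, (1 + (((s p : ℤˣ) : ℤ) : ℝ) * spinAt p.1 ω₀) / 2) *
        gksWeight Finset.univ K C ω₀ := by
        rw [h1, one_mul]; exact gksWeight_pos _ K C ω₀
    _ ≤ ∑ ω, (∏ p : ↥S, (1 + (((s p : ℤˣ) : ℤ) : ℝ) * spinAt p.1 ω) / 2) *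
        gksWeight Finset.univ K C ω :=
        Finset.single_le_sum (f := fun ω => (∏ p : ↥S, (1 + (((s p : ℤˣ) : ℤ) : ℝ) *
          spinAt p.1 ω) / 2) * gksWeight Finset.univ K C ω)
          (fun ω _ => mul_nonneg (cyl_nonneg S s ω) (gksWeight_pos _ K C ω).le) (Finset.mem_univ ω₀)

/-! ## FKG for the pair ferromagnet restricted to a log-supermodular density -/

/-- `ω ↦ σ_x(ω)` is nondecreasing for the product order on `{±1}^{Fin n}` (`-1 < 1`). [folklore] -/
theorem spinAt_monotone {n : ℕ} (x : Fin n) : Monotone fun ω : SpinConfig (Fin n) => spinAt x ω := by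
  intro a b hab
  simp only [spinAt]
  exact Int.cast_le.2 (Units.val_le_val.2 (hab x))

/-- `0 ≤ 1 + σ_x`. [folklore] -/
theorem one_add_spinAt_nonneg {n : ℕ} (x : Fin n) (ω : SpinConfig (Fin n)) : 0 ≤ 1 + spinAt x ω := by
  rcases spinAt_eq_one_or_eq_neg_one x ω with h | h <;> rw [h] <;> norm_num

/-- **FKG lattice condition for the pair-ferromagnet weight**: `w(a) w(b) ≤ w(a ∧ b) w(a ∨ b)` for
`w = exp(∑ᵢ Kᵢ σ_{Cᵢ})` with `Kᵢ ≥ 0`, `|Cᵢ| = 2` (each `σ_uσ_v` is supermodular on `{±1}²`,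
`spin_mul_supermodular`). [folklore] -/
theorem gksWeight_pair_lattice {n m : ℕ} (K : Fin m → ℝ) (C : Fin m → Finset (Fin n))
    (hK : ∀ i, 0 ≤ K i) (hC : ∀ i, (C i).card = 2) (a b : SpinConfig (Fin n)) :
    gksWeight Finset.univ K C a * gksWeight Finset.univ K C b ≤
      gksWeight Finset.univ K C (a ⊓ b) * gksWeight Finset.univ K C (a ⊔ b) := by
  simp only [gksWeight, ← Real.exp_add]
  refine Real.exp_le_exp.2 ?_
  simp only [gksHamiltonian, ← Finset.sum_add_distrib]
  refine Finset.sum_le_sum fun i _ => ?_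
  obtain ⟨u, v, huv, hi⟩ := Finset.card_eq_two.1 (hC i)
  simp only [hi, spinProduct, Finset.prod_pair huv, ← mul_add]
  refine mul_le_mul_of_nonneg_left ?_ (hK i)
  simp only [spinAt, Pi.inf_apply, Pi.sup_apply]
  exact spin_mul_supermodular (a u) (b u) (a v) (b v)

/-- **FKG for one log-supermodular density**: for `χ ≥ 0` with `χ(a)χ(b) ≤ χ(a∧b)χ(a∨b)`,
`Z⟨σ_x χ⟩ · Z⟨σ_y χ⟩ ≤ Z⟨χ⟩ · Z⟨σ_xσ_y χ⟩` (Mathlib's `fkg` for the measure `χ · w` and the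
nonnegative monotone observables `1 + σ_x`, `1 + σ_y`; the linear terms cancel). [folklore] -/
theorem gksSum_mul_gksSum_le_of_fkg {n m : ℕ} (K : Fin m → ℝ) (C : Fin m → Finset (Fin n))
    (hK : ∀ i, 0 ≤ K i) (hC : ∀ i, (C i).card = 2) (x y : Fin n)
    (χ : SpinConfig (Fin n) → ℝ) (hχ0 : ∀ ω, 0 ≤ χ ω)
    (hχ : ∀ a b, χ a * χ b ≤ χ (a ⊓ b) * χ (a ⊔ b)) :
    gksSum Finset.univ K C (fun ω => spinAt x ω * χ ω) *
        gksSum Finset.univ K C (fun ω => spinAt y ω * χ ω) ≤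
      gksSum Finset.univ K C χ *
        gksSum Finset.univ K C (fun ω => spinAt x ω * spinAt y ω * χ ω) := by
  classical
  set μ : SpinConfig (Fin n) → ℝ := fun ω => χ ω * gksWeight Finset.univ K C ω with hμ
  have hμ0 : 0 ≤ μ := fun ω => mul_nonneg (hχ0 ω) (gksWeight_pos _ K C ω).le
  have hf0 : 0 ≤ fun ω : SpinConfig (Fin n) => 1 + spinAt x ω := fun ω => one_add_spinAt_nonneg x ω
  have hg0 : 0 ≤ fun ω : SpinConfig (Fin n) => 1 + spinAt y ω := fun ω => one_add_spinAt_nonneg y ω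
  have hfm : Monotone fun ω : SpinConfig (Fin n) => 1 + spinAt x ω := (spinAt_monotone x).const_add 1
  have hgm : Monotone fun ω : SpinConfig (Fin n) => 1 + spinAt y ω := (spinAt_monotone y).const_add 1
  have hlat : ∀ a b, μ a * μ b ≤ μ (a ⊓ b) * μ (a ⊔ b) := by
    intro a b
    simp only [hμ]
    calc χ a * gksWeight Finset.univ K C a * (χ b * gksWeight Finset.univ K C b)
        = (χ a * χ b) * (gksWeight Finset.univ K C a * gksWeight Finset.univ K C b) := by ring
      _ ≤ (χ (a ⊓ b) * χ (a ⊔ b)) *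
            (gksWeight Finset.univ K C (a ⊓ b) * gksWeight Finset.univ K C (a ⊔ b)) :=
          mul_le_mul (hχ a b) (gksWeight_pair_lattice K C hK hC a b)
            (mul_nonneg (gksWeight_pos _ K C a).le (gksWeight_pos _ K C b).le)
            (mul_nonneg (hχ0 _) (hχ0 _))
      _ = χ (a ⊓ b) * gksWeight Finset.univ K C (a ⊓ b) *
            (χ (a ⊔ b) * gksWeight Finset.univ K C (a ⊔ b)) := by ring
  have key := fkg (fun ω => 1 + spinAt x ω) (fun ω => 1 + spinAt y ω) μ hμ0 hf0 hg0 hfm hgm hlat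
  have eP : gksSum Finset.univ K C χ = ∑ ω, μ ω := by simp [gksSum, hμ]
  have eX : gksSum Finset.univ K C (fun ω => spinAt x ω * χ ω) = ∑ ω, μ ω * spinAt x ω := by
    simp only [gksSum, hμ]
    exact Finset.sum_congr rfl fun ω _ => by ring
  have eY : gksSum Finset.univ K C (fun ω => spinAt y ω * χ ω) = ∑ ω, μ ω * spinAt y ω := by
    simp only [gksSum, hμ]
    exact Finset.sum_congr rfl fun ω _ => by ring
  have eXY : gksSum Finset.univ K C (fun ω => spinAt x ω * spinAt y ω * χ ω) =
      ∑ ω, μ ω * (spinAt x ω * spinAt y ω) := by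
    simp only [gksSum, hμ]
    exact Finset.sum_congr rfl fun ω _ => by ring
  have e1 : ∑ ω, μ ω * (1 + spinAt x ω) = (∑ ω, μ ω) + ∑ ω, μ ω * spinAt x ω := by
    rw [← Finset.sum_add_distrib]
    exact Finset.sum_congr rfl fun ω _ => by ring
  have e2 : ∑ ω, μ ω * (1 + spinAt y ω) = (∑ ω, μ ω) + ∑ ω, μ ω * spinAt y ω := by
    rw [← Finset.sum_add_distrib]
    exact Finset.sum_congr rfl fun ω _ => by ring
  have e3 : ∑ ω, μ ω * ((1 + spinAt x ω) * (1 + spinAt y ω)) = (∑ ω, μ ω) +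
      ∑ ω, μ ω * spinAt x ω + ∑ ω, μ ω * spinAt y ω + ∑ ω, μ ω * (spinAt x ω * spinAt y ω) := by
    rw [← Finset.sum_add_distrib, ← Finset.sum_add_distrib, ← Finset.sum_add_distrib]
    exact Finset.sum_congr rfl fun ω _ => by ring
  rw [e1, e2, e3] at key
  rw [eP, eX, eY, eXY]
  linear_combination key

/-- **Partition into cylinders**: if `∑_s χ_s = 1` pointwise then `Z⟨F⟩ = ∑_s Z⟨F χ_s⟩`. [folklore] -/
theorem gksSum_eq_sum_gksSum_mul {n m : ℕ} (K : Fin m → ℝ) (C : Fin m → Finset (Fin n))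
    {ι : Type*} [Fintype ι] (χ : ι → SpinConfig (Fin n) → ℝ) (hχsum : ∀ ω, ∑ s, χ s ω = 1)
    (F : SpinConfig (Fin n) → ℝ) :
    gksSum Finset.univ K C F = ∑ s, gksSum Finset.univ K C (fun ω => F ω * χ s ω) := by
  simp only [gksSum]
  rw [Finset.sum_comm]
  refine Finset.sum_congr rfl fun ω _ => ?_
  rw [← Finset.sum_mul, ← Finset.mul_sum, hχsum ω, mul_one]

/-- **Nonnegativity of the averaged conditional covariance, abstract form**: for a family of
nonnegative log-supermodular densities `χ_s` of positive mass with `∑_s χ_s = 1`,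
`∑_s ⟨σ_x χ_s⟩⟨σ_y χ_s⟩/⟨χ_s⟩ ≤ ⟨σ_xσ_y⟩`. [folklore] -/
theorem condCov_sum_le_general {n m : ℕ} (K : Fin m → ℝ) (C : Fin m → Finset (Fin n))
    (hK : ∀ i, 0 ≤ K i) (hC : ∀ i, (C i).card = 2) (x y : Fin n) {ι : Type*} [Fintype ι]
    (χ : ι → SpinConfig (Fin n) → ℝ) (hχ0 : ∀ s ω, 0 ≤ χ s ω)
    (hχlat : ∀ s a b, χ s a * χ s b ≤ χ s (a ⊓ b) * χ s (a ⊔ b))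
    (hχpos : ∀ s, 0 < gksSum Finset.univ K C (χ s)) (hχsum : ∀ ω, ∑ s, χ s ω = 1) :
    ∑ s, gksExpect Finset.univ K C (fun ω => spinAt x ω * χ s ω) *
        gksExpect Finset.univ K C (fun ω => spinAt y ω * χ s ω) / gksExpect Finset.univ K C (χ s) ≤
      gksExpect Finset.univ K C (fun ω => spinAt x ω * spinAt y ω) := by
  classical
  have hZ := gksSum_one_pos Finset.univ K C
  simp only [gksExpect]
  set Z : ℝ := gksSum Finset.univ K C (fun _ => 1) with hZdef
  have halg : ∀ a b p : ℝ, a / Z * (b / Z) / (p / Z) = a * b / p / Z := by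
    intro a b p
    rcases eq_or_ne p 0 with rfl | hp
    · simp
    · field_simp
  simp only [halg]
  rw [← Finset.sum_div]
  refine div_le_div_of_nonneg_right ?_ hZ.le
  rw [gksSum_eq_sum_gksSum_mul K C χ hχsum (fun ω => spinAt x ω * spinAt y ω)]
  refine Finset.sum_le_sum fun s _ => ?_
  rw [div_le_iff₀ (hχpos s)]
  exact (gksSum_mul_gksSum_le_of_fkg K C hK hC x y (χ s) (hχ0 s) (hχlat s)).trans
    (le_of_eq (mul_comm _ _))

/-! ## The stub -/

/-- **Conditional covariances are nonnegative** (stub `stub_condCov_nonneg` of the line `Sketch`):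
for a zero-field pair ferromagnet (`Kᵢ ≥ 0`, `|Cᵢ| = 2`) and the cylinder indicators
`1_s = ∏_{p∈S}(1 + s_pσ_p)/2`, `∑_s ⟨σ_x 1_s⟩⟨σ_y 1_s⟩/⟨1_s⟩ ≤ ⟨σ_xσ_y⟩`, i.e.
`E[Cov(σ_x, σ_y | σ_S)] ≥ 0`, by FKG applied to the log-supermodular weights `1_s · e^{∑ Kᵢσ_{Cᵢ}}`. [folklore] -/
theorem stub_condCov_nonneg : ∀ (n m : ℕ) (K : Fin m → ℝ) (C : Fin m → Finset (Fin n)), (∀ i, 0 ≤ K i) → (∀ i, (C i).card = 2) → ∀ (x y : Fin n) (S : Finset (Fin n)), x ∉ S → y ∉ S → ∑ s : (↥S → ℤˣ), gksExpect Finset.univ K C (fun ω => spinAt x ω * ∏ p : ↥S, (1 + (((s p : ℤˣ) : ℤ) : ℝ) * spinAt p.1 ω) / 2) * gksExpect Finset.univ K C (fun ω => spinAt y ω * ∏ p : ↥S, (1 + (((s p : ℤˣ) : ℤ) : ℝ) * spinAt p.1 ω) / 2) / gksExpect Finset.univ K C (fun ω => ∏ p : ↥S, (1 + (((s p : ℤˣ)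 : ℤ) : ℝ) * spinAt p.1 ω) / 2) ≤ gksExpect Finset.univ K C (fun ω => spinAt x ω * spinAt y ω) := by
  intro n m K C hK hC x y S _ _
  exact condCov_sum_le_general K C hK hC x y
    (fun (s : ↥S → ℤˣ) (ω : SpinConfig (Fin n)) =>
      ∏ p : ↥S, (1 + (((s p : ℤˣ) : ℤ) : ℝ) * spinAt p.1 ω) / 2)
    (cyl_nonneg S) (cyl_lattice S) (gksSum_cyl_pos K C S) (sum_cyl_eq_one S)

end

end Summit.CriticalPhenomena.Ising3DConformalLimit.Cruxes.InverseMFerromagnet.PartialCovarianceLadder
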